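import Mathlib
import Literature.Analysis.FluidPDE.Tao2016AveragedNS.WeightedLatticeFlows
import HarnessLib

/-!
# `SubcriticalEnvelope.ForwardSourceSmoothing` (stmt-NavierStokesRegularity-26374, crux B⁺) — stage α:
the energy flux into the NON-SOURCE modes of one shell (helper file, `--supports`)

Crux B⁺ asks: if a mode set `S` contains every FORWARD SOURCE of the table (`i ∉ S ⇒ α i j l (0,0,1)
= 0`) and the `S`-mode partial tail energies of the regular `ν`-viscous lattice solutions obey a
window-wise subcritical envelope, then a global regular viscous solution exists.  The step beyond the
landed engine `exists_viscousGlobal_of_subcriticalEnvelope` (envelope on ALL modes) is the SLAVING of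
the non-source modes `D = Sᶜ`; its algebraic heart is the energy flux
`Φ^D_n = Σ_{d ∈ D} X_{d,n} · quadTerm_{d,n}(X)` into the `D`-modes of ONE shell, settled here for a
general symmetric (4.2), cancelling (4.3) table on `m` modes:
* `forwardSourceSmoothing_inShell_DDD_eq_zero` — the pure-`D` in-shell part (shift `(0,0,0)`)
  vanishes (six-fold symmetrisation of (4.3); any index set `D`);
* `forwardSourceSmoothing_rotor_eq_zero` — two-shell triads `{(c,n+1),(a,n),(d,n)}` with `a, d ∈ D`
  contribute nothing: their `(0,0,1)` coefficients vanish (`a, d` are not sources), so by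
  (4.2)–(4.3) `α c a d (1,0,0)` is antisymmetric in `(a,d)` — a ROTOR inside shell `n`;
* `forwardSourceSmoothing_abs_flux_le` — every surviving term carries a source amplitude on shell
  `n` (or two on shell `n−1`):
  `|Φ^D_n| ≤ m³ M_α (2 (1+ε₀)^{5n/2} p₀ q₀ (p₀ + q₀ + p₁ + q₁) + (1+ε₀)^{5(n−1)/2} p₋² q₀)`
  for amplitude bounds `p` (sources, shells `n, n+1, n−1`) and `q` (non-sources, shells `n, n+1`).
With a subcritical `S`-envelope the linear rate is `≍ (1+ε₀)^{(2−η/2)n}`, beaten by the dissipation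
`ν(1+ε₀)^{2n}` for large `n` (the analytic stage, separate file).

HONEST FRAMING: finite-dimensional algebra about Tao-type MODEL lattice ODEs (Tao 2016 §4); nothing
here bears on the Navier–Stokes equations, and no summit is proved.
-/

noncomputable section

-- the sub-problem namespace `NavierStokesRegularity.NavierStokesRegularity` is the tree's layout (D-0017)
set_option linter.dupNamespace false

namespace Summit.NavierStokesRegularity.NavierStokesRegularity.Theorems

open Finset
open Literature.Analysis.FluidPDE.TaoCascade

variable {m : ℕ}

/-! ## Generic bookkeeping -/

/-- A triple sum over subsets of `Fin m` whose terms are bounded by `K ≥ 0` is bounded by `m³ K`.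
[folklore] -/
theorem forwardSourceSmoothing_abs_sum3_le {A B D : Finset (Fin m)} {f : Fin m → Fin m → Fin m → ℝ}
    {K : ℝ} (hK : 0 ≤ K) (h : ∀ d ∈ D, ∀ a ∈ A, ∀ b ∈ B, |f d a b| ≤ K) :
    |∑ d ∈ D, ∑ a ∈ A, ∑ b ∈ B, f d a b| ≤ (m : ℝ) ^ 3 * K := by
  have hcard : ∀ E : Finset (Fin m), (E.card : ℝ) ≤ m := fun E => by
    exact_mod_cast (card_le_univ E).trans_eq (by simp)
  have hm0 : (0 : ℝ) ≤ m := Nat.cast_nonneg m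
  calc |∑ d ∈ D, ∑ a ∈ A, ∑ b ∈ B, f d a b|
      ≤ ∑ d ∈ D, |∑ a ∈ A, ∑ b ∈ B, f d a b| := abs_sum_le_sum_abs _ _
    _ ≤ ∑ d ∈ D, ∑ a ∈ A, |∑ b ∈ B, f d a b| := sum_le_sum fun d _ => abs_sum_le_sum_abs _ _
    _ ≤ ∑ d ∈ D, ∑ a ∈ A, ∑ b ∈ B, |f d a b| :=
        sum_le_sum fun d _ => sum_le_sum fun a _ => abs_sum_le_sum_abs _ _
    _ ≤ ∑ d ∈ D, ∑ a ∈ A, ∑ _b ∈ B, K :=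
        sum_le_sum fun d hd => sum_le_sum fun a ha => sum_le_sum fun b hb => h d hd a ha b hb
    _ = (D.card : ℝ) * ((A.card : ℝ) * ((B.card : ℝ) * K)) := by
        simp only [sum_const, nsmul_eq_mul]
    _ ≤ (m : ℝ) * ((m : ℝ) * ((m : ℝ) * K)) := by
        have hB0 : 0 ≤ (B.card : ℝ) * K := mul_nonneg (Nat.cast_nonneg _) hK
        have hA : (A.card : ℝ) * ((B.card : ℝ) * K) ≤ m * (m * K) :=
          mul_le_mul (hcard A) (mul_le_mul_of_nonneg_right (hcard B) hK) hB0 hm0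
        exact mul_le_mul (hcard D) hA (mul_nonneg (Nat.cast_nonneg _) hB0) hm0
    _ = (m : ℝ) ^ 3 * K := by ring

/-- `|a| ≤ A`, `|u| ≤ U`, `|v| ≤ V`, `|w| ≤ W` (all bounds `≥ 0`) give `|w·(a·(u·v))| ≤ A·U·V·W`.
[folklore] -/
theorem forwardSourceSmoothing_abs_term_le {a u v w A U V W : ℝ} (hA : 0 ≤ A) (hU : 0 ≤ U)
    (ha : |a| ≤ A) (hu : |u| ≤ U) (hv : |v| ≤ V) (hw : |w| ≤ W) :
    |w * (a * (u * v))| ≤ A * U * V * W := by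
  rw [abs_mul, abs_mul, abs_mul]
  have h2 : |a| * (|u| * |v|) ≤ A * (U * V) :=
    mul_le_mul ha (mul_le_mul hu hv (abs_nonneg _) hU) (by positivity) hA
  have h3 : |w| * (|a| * (|u| * |v|)) ≤ W * (A * (U * V)) :=
    mul_le_mul hw h2 (by positivity) ((abs_nonneg _).trans hw)
  linarith

/-! ## The two cancellations -/

/-- **Pure-`D` in-shell triads move no `D`-energy.** For a cancelling table (4.3) and ANY index set
`D`, `Σ_{d,a,b ∈ D} x_d · α a b d (0,0,0) · x_a x_b = 0`: the cubic form is invariant under the six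
permutations of `(a,b,d)` while the coefficients sum to zero over them. [cite: Tao2016AveragedNS, §4
(4.3) and proof of Lemma 4.1 (v)] -/
theorem forwardSourceSmoothing_inShell_DDD_eq_zero
    {α : Fin m → Fin m → Fin m → ℤ × ℤ × ℤ → ℝ} (hc : IsCancellingCoeff α) (D : Finset (Fin m))
    (x : Fin m → ℝ) :
    ∑ d ∈ D, ∑ a ∈ D, ∑ b ∈ D, x d * (α a b d (0, 0, 0) * (x a * x b)) = 0 := by
  have h0 : ((0 : ℤ), (0 : ℤ), (0 : ℤ)) ∈ shiftSet := (mem_shiftSet_iff _).2 (Or.inl rfl)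
  -- the cancellation identity at the shift `(0,0,0)`
  have key : ∀ a b d : Fin m, α a b d (0, 0, 0) + α a d b (0, 0, 0) + α b a d (0, 0, 0) +
      α b d a (0, 0, 0) + α d a b (0, 0, 0) + α d b a (0, 0, 0) = 0 := fun a b d => hc a b d 0 0 0 h0
  set T : ℝ := ∑ d ∈ D, ∑ a ∈ D, ∑ b ∈ D, x d * (α a b d (0, 0, 0) * (x a * x b)) with hT
  have hT' : T = ∑ a ∈ D, ∑ b ∈ D, ∑ d ∈ D, α a b d (0, 0, 0) * (x a * x b * x d) := by
    rw [hT, sum_comm]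
    refine sum_congr rfl fun a _ => ?_
    rw [sum_comm]
    refine sum_congr rfl fun b _ => sum_congr rfl fun d _ => by ring
  -- the six permuted copies of `T`
  have P2 : ∑ a ∈ D, ∑ b ∈ D, ∑ d ∈ D, α a d b (0, 0, 0) * (x a * x b * x d) = T := by
    rw [hT']
    refine sum_congr rfl fun a _ => ?_
    rw [sum_comm]
    exact sum_congr rfl fun b _ => sum_congr rfl fun d _ => by ring
  have P3 : ∑ a ∈ D, ∑ b ∈ D, ∑ d ∈ D, α b a d (0, 0, 0) * (x a * x b * x d) = T := by
    rw [hT', sum_comm]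
    exact sum_congr rfl fun a _ => sum_congr rfl fun b _ => sum_congr rfl fun d _ => by ring
  have P4 : ∑ a ∈ D, ∑ b ∈ D, ∑ d ∈ D, α b d a (0, 0, 0) * (x a * x b * x d) = T := by
    rw [hT', sum_comm]
    refine sum_congr rfl fun b _ => ?_
    rw [sum_comm]
    exact sum_congr rfl fun d _ => sum_congr rfl fun a _ => by ring
  have P5 : ∑ a ∈ D, ∑ b ∈ D, ∑ d ∈ D, α d a b (0, 0, 0) * (x a * x b * x d) = T := by
    rw [hT']
    have : ∑ a ∈ D, ∑ b ∈ D, ∑ d ∈ D, α d a b (0, 0, 0) * (x a * x b * x d) =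
        ∑ a ∈ D, ∑ d ∈ D, ∑ b ∈ D, α d a b (0, 0, 0) * (x a * x b * x d) :=
      sum_congr rfl fun a _ => sum_comm
    rw [this, sum_comm]
    exact sum_congr rfl fun d _ => sum_congr rfl fun a _ => sum_congr rfl fun b _ => by ring
  have P6 : ∑ a ∈ D, ∑ b ∈ D, ∑ d ∈ D, α d b a (0, 0, 0) * (x a * x b * x d) = T := by
    rw [hT']
    have : ∑ a ∈ D, ∑ b ∈ D, ∑ d ∈ D, α d b a (0, 0, 0) * (x a * x b * x d) =
        ∑ a ∈ D, ∑ d ∈ D, ∑ b ∈ D, α d b a (0, 0, 0) * (x a * x b * x d) :=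
      sum_congr rfl fun a _ => sum_comm
    rw [this, sum_comm]
    refine sum_congr rfl fun d _ => ?_
    rw [sum_comm]
    exact sum_congr rfl fun b _ => sum_congr rfl fun a _ => by ring
  have hsum : ∑ a ∈ D, ∑ b ∈ D, ∑ d ∈ D, α a b d (0, 0, 0) * (x a * x b * x d) +
      ∑ a ∈ D, ∑ b ∈ D, ∑ d ∈ D, α a d b (0, 0, 0) * (x a * x b * x d) +
      ∑ a ∈ D, ∑ b ∈ D, ∑ d ∈ D, α b a d (0, 0, 0) * (x a * x b * x d) +
      ∑ a ∈ D, ∑ b ∈ D, ∑ d ∈ D, α b d a (0, 0, 0) * (x a * x b * x d) +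
      ∑ a ∈ D, ∑ b ∈ D, ∑ d ∈ D, α d a b (0, 0, 0) * (x a * x b * x d) +
      ∑ a ∈ D, ∑ b ∈ D, ∑ d ∈ D, α d b a (0, 0, 0) * (x a * x b * x d) = 0 := by
    have h : ∑ a ∈ D, ∑ b ∈ D, ∑ d ∈ D, (α a b d (0, 0, 0) + α a d b (0, 0, 0) +
        α b a d (0, 0, 0) + α b d a (0, 0, 0) + α d a b (0, 0, 0) + α d b a (0, 0, 0)) *
          (x a * x b * x d) = 0 :=
      sum_eq_zero fun a _ => sum_eq_zero fun b _ => sum_eq_zero fun d _ => by rw [key, zero_mul]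
    simpa only [add_mul, sum_add_distrib] using h
  rw [← hT', P2, P3, P4, P5, P6] at hsum
  linarith

/-- **`D`-partnered two-shell triads are rotors inside the lower shell.** Let the table be symmetric
(4.2) and cancelling (4.3), and let no index of `D` be a forward source (`d ∈ D ⇒ α d j l (0,0,1) =
0`).  Then for the shell-`n` amplitudes `x` and the shell-`(n+1)` amplitudes `y`,
`Σ_{d∈D} x_d (Σ_c Σ_{a∈D} α c a d (1,0,0) y_c x_a + Σ_{a∈D} Σ_c α a c d (0,1,0) x_a y_c) = 0`:
by (4.3) at `((c,1),(a,0),(d,0))` the two `(0,0,1)` terms vanish and (4.2) folds the rest into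
`2(α c a d (1,0,0) + α c d a (1,0,0)) = 0`, an antisymmetric form in `(a,d)`. [cite: Tao2016AveragedNS,
§4 (4.2)–(4.3)] -/
theorem forwardSourceSmoothing_rotor_eq_zero
    {α : Fin m → Fin m → Fin m → ℤ × ℤ × ℤ → ℝ} (hs : IsSymmetricCoeff α) (hc : IsCancellingCoeff α)
    (D : Finset (Fin m)) (hD : ∀ d ∈ D, ∀ j l : Fin m, α d j l (0, 0, 1) = 0) (x y : Fin m → ℝ) :
    ∑ d ∈ D, ∑ c, ∑ a ∈ D, x d * (α c a d (1, 0, 0) * (y c * x a)) +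
      ∑ d ∈ D, ∑ a ∈ D, ∑ c, x d * (α a c d (0, 1, 0) * (x a * y c)) = 0 := by
  have h100 : ((1 : ℤ), (0 : ℤ), (0 : ℤ)) ∈ shiftSet := (mem_shiftSet_iff _).2 (Or.inr (Or.inl rfl))
  have h010 : ((0 : ℤ), (1 : ℤ), (0 : ℤ)) ∈ shiftSet :=
    (mem_shiftSet_iff _).2 (Or.inr (Or.inr (Or.inl rfl)))
  -- symmetry folds `(0,1,0)` onto `(1,0,0)`
  have hsym : ∀ a c d : Fin m, α a c d (0, 1, 0) = α c a d (1, 0, 0) := fun a c d =>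
    hs a c d 0 1 0 h010
  -- antisymmetry of `α c · · (1,0,0)` on `D × D`
  have hanti : ∀ c, ∀ a ∈ D, ∀ d ∈ D, α c a d (1, 0, 0) + α c d a (1, 0, 0) = 0 := by
    intro c a ha d hd
    have h := hc c a d 1 0 0 h100
    rw [hD a ha d c, hD d hd a c, hsym a c d, hsym d c a] at h
    linarith
  -- the `(0,1,0)` sum equals the `(1,0,0)` sum
  have hB : ∑ d ∈ D, ∑ a ∈ D, ∑ c, x d * (α a c d (0, 1, 0) * (x a * y c)) =
      ∑ d ∈ D, ∑ c, ∑ a ∈ D, x d * (α c a d (1, 0, 0) * (y c * x a)) := by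
    refine sum_congr rfl fun d _ => ?_
    rw [sum_comm]
    exact sum_congr rfl fun c _ => sum_congr rfl fun a _ => by rw [hsym]; ring
  -- the `(1,0,0)` sum vanishes: bring `c` outside, then antisymmetrise in `(a,d)`
  have hA : ∑ d ∈ D, ∑ c, ∑ a ∈ D, x d * (α c a d (1, 0, 0) * (y c * x a)) =
      ∑ c, y c * ∑ d ∈ D, ∑ a ∈ D, α c a d (1, 0, 0) * (x a * x d) := by
    rw [sum_comm]
    refine sum_congr rfl fun c _ => ?_
    rw [mul_sum]
    exact sum_congr rfl fun d _ => by
      rw [mul_sum]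
      exact sum_congr rfl fun a _ => by ring
  have hR : ∀ c, ∑ d ∈ D, ∑ a ∈ D, α c a d (1, 0, 0) * (x a * x d) = 0 := by
    intro c
    set R : ℝ := ∑ d ∈ D, ∑ a ∈ D, α c a d (1, 0, 0) * (x a * x d) with hRdef
    have hswap : R = ∑ d ∈ D, ∑ a ∈ D, α c d a (1, 0, 0) * (x a * x d) := by
      rw [hRdef, sum_comm]
      exact sum_congr rfl fun a _ => sum_congr rfl fun d _ => by ring
    have h2 : R + R = 0 := by
      nth_rewrite 2 [hswap]
      rw [hRdef, ← sum_add_distrib]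
      refine sum_eq_zero fun d hd => ?_
      rw [← sum_add_distrib]
      refine sum_eq_zero fun a ha => ?_
      rw [← add_mul, hanti c a ha d hd, zero_mul]
    linarith
  rw [hB, hA]
  simp only [hR, mul_zero, sum_const_zero, add_zero]

/-! ## Splitting index sums along `S` / `Sᶜ` -/

/-- Split the middle index of a triple sum along `S ⊔ Sᶜ`. [folklore] -/
theorem forwardSourceSmoothing_split_mid (S D B : Finset (Fin m)) (f : Fin m → Fin m → Fin m → ℝ) :
    ∑ d ∈ D, ∑ a, ∑ b ∈ B, f d a b =
      ∑ d ∈ D, ∑ a ∈ S, ∑ b ∈ B, f d a b + ∑ d ∈ D, ∑ a ∈ Sᶜ, ∑ b ∈ B, f d a b := by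
  rw [← sum_add_distrib]
  exact sum_congr rfl fun d _ => (sum_add_sum_compl S _).symm

/-- Split the inner index of a triple sum along `S ⊔ Sᶜ`. [folklore] -/
theorem forwardSourceSmoothing_split_inner (S D A : Finset (Fin m))
    (f : Fin m → Fin m → Fin m → ℝ) :
    ∑ d ∈ D, ∑ a ∈ A, ∑ b, f d a b =
      ∑ d ∈ D, ∑ a ∈ A, ∑ b ∈ S, f d a b + ∑ d ∈ D, ∑ a ∈ A, ∑ b ∈ Sᶜ, f d a b := by
  rw [← sum_add_distrib]
  refine sum_congr rfl fun d _ => ?_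
  rw [← sum_add_distrib]
  exact sum_congr rfl fun a _ => (sum_add_sum_compl S _).symm

/-! ## The flux into the non-source modes of one shell -/

/-- **The `D`-energy flux bound.** Let the table `α` be symmetric (4.2) and cancelling (4.3) with
structure constants bounded by `M_α` on the shift set, let `S` contain every forward source
(`i ∉ S ⇒ α i j l (0,0,1) = 0`), and at time `t` let the amplitudes obey `|X_{s,n}| ≤ p₀`,
`|X_{s,n+1}| ≤ p₁`, `|X_{s,n-1}| ≤ p₋` for `s ∈ S` and `|X_{d,n}| ≤ q₀`, `|X_{d,n+1}| ≤ q₁` for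
`d ∉ S`.  Then the energy flux into the non-source modes of shell `n`,
`Φ^D_n = Σ_{d ∉ S} X_{d,n} · quadTerm_{d,n}(X)`, obeys
`|Φ^D_n| ≤ m³ M_α (2 (1+ε₀)^{5n/2} p₀ q₀ (p₀ + q₀ + p₁ + q₁) + (1+ε₀)^{5(n-1)/2} p₋² q₀)`:
after the pure-`D` in-shell cancellation (`forwardSourceSmoothing_inShell_DDD_eq_zero`) and the
rotor cancellation (`forwardSourceSmoothing_rotor_eq_zero`), every surviving term carries a source
amplitude on shell `n` (or two on shell `n-1`) and a `D`-amplitude on shell `n`.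
[cite: Tao2016AveragedNS, §4 (4.2)–(4.3), (4.8)] -/
theorem forwardSourceSmoothing_abs_flux_le {ε₀ Mα p₀ q₀ p₁ q₁ pm : ℝ} (hε : 0 ≤ 1 + ε₀)
    (hMα : 0 ≤ Mα) {α : Fin m → Fin m → Fin m → ℤ × ℤ × ℤ → ℝ} (hs : IsSymmetricCoeff α)
    (hc : IsCancellingCoeff α) (hα : ∀ i₁ i₂ i₃ μ, μ ∈ shiftSet → |α i₁ i₂ i₃ μ| ≤ Mα)
    (S : Finset (Fin m)) (hS : ∀ i, i ∉ S → ∀ j l : Fin m, α i j l (0, 0, 1) = 0)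
    (X : Fin m → ℤ → ℝ → ℝ) (n : ℤ) (t : ℝ)
    (hp₀ : 0 ≤ p₀) (hq₀ : 0 ≤ q₀) (hp₁ : 0 ≤ p₁) (hq₁ : 0 ≤ q₁) (hpm : 0 ≤ pm)
    (hS0 : ∀ i ∈ S, |X i n t| ≤ p₀) (hD0 : ∀ i, i ∉ S → |X i n t| ≤ q₀)
    (hS1 : ∀ i ∈ S, |X i (n + 1) t| ≤ p₁) (hD1 : ∀ i, i ∉ S → |X i (n + 1) t| ≤ q₁)
    (hSm : ∀ i ∈ S, |X i (n - 1) t| ≤ pm) :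
    |∑ d ∈ Sᶜ, X d n t * quadTerm ε₀ α X d n t| ≤
      (m : ℝ) ^ 3 * Mα * (2 * (1 + ε₀) ^ ((5 : ℝ) * n / 2) * p₀ * q₀ * (p₀ + q₀ + p₁ + q₁) +
        (1 + ε₀) ^ ((5 : ℝ) * ((n : ℝ) - 1) / 2) * pm ^ 2 * q₀) := by
  have h000 : ((0 : ℤ), (0 : ℤ), (0 : ℤ)) ∈ shiftSet := by simp [shiftSet]
  have h100 : ((1 : ℤ), (0 : ℤ), (0 : ℤ)) ∈ shiftSet := by simp [shiftSet]
  have h010 : ((0 : ℤ), (1 : ℤ), (0 : ℤ)) ∈ shiftSet := by simp [shiftSet]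
  have h001 : ((0 : ℤ), (0 : ℤ), (1 : ℤ)) ∈ shiftSet := by simp [shiftSet]
  have hx : ∀ i, |X i n t| ≤ p₀ + q₀ := fun i => by
    by_cases hi : i ∈ S
    · exact (hS0 i hi).trans (le_add_of_nonneg_right hq₀)
    · exact (hD0 i hi).trans (le_add_of_nonneg_left hp₀)
  have hy : ∀ i, |X i (n + 1) t| ≤ p₁ + q₁ := fun i => by
    by_cases hi : i ∈ S
    · exact (hS1 i hi).trans (le_add_of_nonneg_right hq₁)
    · exact (hD1 i hi).trans (le_add_of_nonneg_left hp₁)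
  have hDmem : ∀ d ∈ Sᶜ, d ∉ S := fun d hd => mem_compl.1 hd
  have hw0 : 0 ≤ p₀ + q₀ := add_nonneg hp₀ hq₀
  have hw1 : 0 ≤ p₁ + q₁ := add_nonneg hp₁ hq₁
  have hP : 0 ≤ (1 + ε₀) ^ ((5 : ℝ) * n / 2) := Real.rpow_nonneg hε _
  have hQ : 0 ≤ (1 + ε₀) ^ ((5 : ℝ) * ((n : ℝ) - 1) / 2) := Real.rpow_nonneg hε _
  -- Step 1: expand the nonlinearity over the four shifts
  have hterm : ∀ d, X d n t * quadTerm ε₀ α X d n t =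
      (1 + ε₀) ^ ((5 : ℝ) * n / 2) * (X d n t * ∑ i₁, ∑ i₂,
        (α i₁ i₂ d (0, 0, 0) * (X i₁ n t * X i₂ n t) +
          α i₁ i₂ d (1, 0, 0) * (X i₁ (n + 1) t * X i₂ n t) +
          α i₁ i₂ d (0, 1, 0) * (X i₁ n t * X i₂ (n + 1) t))) +
      (1 + ε₀) ^ ((5 : ℝ) * ((n : ℝ) - 1) / 2) * (X d n t * ∑ i₁, ∑ i₂,
        α i₁ i₂ d (0, 0, 1) * (X i₁ (n - 1) t * X i₂ (n - 1) t)) := by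
    intro d; rw [quadTerm_four_shifts]; ring
  have hinner1 : ∀ d, X d n t * ∑ i₁, ∑ i₂,
        (α i₁ i₂ d (0, 0, 0) * (X i₁ n t * X i₂ n t) +
          α i₁ i₂ d (1, 0, 0) * (X i₁ (n + 1) t * X i₂ n t) +
          α i₁ i₂ d (0, 1, 0) * (X i₁ n t * X i₂ (n + 1) t)) =
      ∑ i₁, ∑ i₂, X d n t * (α i₁ i₂ d (0, 0, 0) * (X i₁ n t * X i₂ n t)) +
      ∑ i₁, ∑ i₂, X d n t * (α i₁ i₂ d (1, 0, 0) * (X i₁ (n + 1) t * X i₂ n t)) +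
      ∑ i₁, ∑ i₂, X d n t * (α i₁ i₂ d (0, 1, 0) * (X i₁ n t * X i₂ (n + 1) t)) := by
    intro d
    simp only [mul_sum, mul_add, sum_add_distrib]
  have hinner2 : ∀ d, X d n t * ∑ i₁, ∑ i₂, α i₁ i₂ d (0, 0, 1) * (X i₁ (n - 1) t * X i₂ (n - 1) t) =
      ∑ i₁, ∑ i₂, X d n t * (α i₁ i₂ d (0, 0, 1) * (X i₁ (n - 1) t * X i₂ (n - 1) t)) := by
    intro d
    simp only [mul_sum]
  -- the four cubic pieces and the expansion of the flux
  have hΦ : ∑ d ∈ Sᶜ, X d n t * quadTerm ε₀ α X d n t =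
      (1 + ε₀) ^ ((5 : ℝ) * n / 2) *
        (∑ d ∈ Sᶜ, ∑ i₁, ∑ i₂, X d n t * (α i₁ i₂ d (0, 0, 0) * (X i₁ n t * X i₂ n t)) +
          ∑ d ∈ Sᶜ, ∑ i₁, ∑ i₂, X d n t * (α i₁ i₂ d (1, 0, 0) * (X i₁ (n + 1) t * X i₂ n t)) +
          ∑ d ∈ Sᶜ, ∑ i₁, ∑ i₂, X d n t * (α i₁ i₂ d (0, 1, 0) * (X i₁ n t * X i₂ (n + 1) t))) +
      (1 + ε₀) ^ ((5 : ℝ) * ((n : ℝ) - 1) / 2) *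
        ∑ d ∈ Sᶜ, ∑ i₁, ∑ i₂, X d n t * (α i₁ i₂ d (0, 0, 1) * (X i₁ (n - 1) t * X i₂ (n - 1) t)) := by
    rw [show ∑ d ∈ Sᶜ, X d n t * quadTerm ε₀ α X d n t = ∑ d ∈ Sᶜ,
        ((1 + ε₀) ^ ((5 : ℝ) * n / 2) *
          (∑ i₁, ∑ i₂, X d n t * (α i₁ i₂ d (0, 0, 0) * (X i₁ n t * X i₂ n t)) +
            ∑ i₁, ∑ i₂, X d n t * (α i₁ i₂ d (1, 0, 0) * (X i₁ (n + 1) t * X i₂ n t)) +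
            ∑ i₁, ∑ i₂, X d n t * (α i₁ i₂ d (0, 1, 0) * (X i₁ n t * X i₂ (n + 1) t))) +
        (1 + ε₀) ^ ((5 : ℝ) * ((n : ℝ) - 1) / 2) *
          ∑ i₁, ∑ i₂, X d n t * (α i₁ i₂ d (0, 0, 1) * (X i₁ (n - 1) t * X i₂ (n - 1) t))) from
      sum_congr rfl fun d _ => by rw [hterm, hinner1, hinner2]]
    rw [sum_add_distrib, ← mul_sum, ← mul_sum, sum_add_distrib, sum_add_distrib]
  -- Step 2: the `(0,0,0)` piece
  have hB000 : |∑ d ∈ Sᶜ, ∑ i₁, ∑ i₂, X d n t * (α i₁ i₂ d (0, 0, 0) * (X i₁ n t * X i₂ n t))| ≤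
      2 * ((m : ℝ) ^ 3 * (Mα * p₀ * (p₀ + q₀) * q₀)) := by
    have hsplit : ∑ d ∈ Sᶜ, ∑ i₁, ∑ i₂, X d n t * (α i₁ i₂ d (0, 0, 0) * (X i₁ n t * X i₂ n t)) =
        ∑ d ∈ Sᶜ, ∑ i₁ ∈ S, ∑ i₂, X d n t * (α i₁ i₂ d (0, 0, 0) * (X i₁ n t * X i₂ n t)) +
        (∑ d ∈ Sᶜ, ∑ i₁ ∈ Sᶜ, ∑ i₂ ∈ S, X d n t * (α i₁ i₂ d (0, 0, 0) * (X i₁ n t * X i₂ n t)) +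
          ∑ d ∈ Sᶜ, ∑ i₁ ∈ Sᶜ, ∑ i₂ ∈ Sᶜ,
            X d n t * (α i₁ i₂ d (0, 0, 0) * (X i₁ n t * X i₂ n t))) := by
      rw [forwardSourceSmoothing_split_mid S, forwardSourceSmoothing_split_inner S Sᶜ Sᶜ]
    have hDDD := forwardSourceSmoothing_inShell_DDD_eq_zero hc Sᶜ (fun i => X i n t)
    rw [hsplit, hDDD, add_zero]
    refine (abs_add_le _ _).trans ?_
    have h1 : |∑ d ∈ Sᶜ, ∑ i₁ ∈ S, ∑ i₂, X d n t * (α i₁ i₂ d (0, 0, 0) * (X i₁ n t * X i₂ n t))|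
        ≤ (m : ℝ) ^ 3 * (Mα * p₀ * (p₀ + q₀) * q₀) :=
      forwardSourceSmoothing_abs_sum3_le (by positivity) fun d hd i₁ hi₁ i₂ _ =>
        forwardSourceSmoothing_abs_term_le hMα hp₀ (hα _ _ _ _ h000) (hS0 i₁ hi₁) (hx i₂)
          (hD0 d (hDmem d hd))
    have h2 : |∑ d ∈ Sᶜ, ∑ i₁ ∈ Sᶜ, ∑ i₂ ∈ S, X d n t * (α i₁ i₂ d (0, 0, 0) * (X i₁ n t * X i₂ n t))|
        ≤ (m : ℝ) ^ 3 * (Mα * (p₀ + q₀) * p₀ * q₀) :=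
      forwardSourceSmoothing_abs_sum3_le (by positivity) fun d hd i₁ _ i₂ hi₂ =>
        forwardSourceSmoothing_abs_term_le hMα hw0 (hα _ _ _ _ h000) (hx i₁) (hS0 i₂ hi₂)
          (hD0 d (hDmem d hd))
    have h3 : (m : ℝ) ^ 3 * (Mα * (p₀ + q₀) * p₀ * q₀) = (m : ℝ) ^ 3 * (Mα * p₀ * (p₀ + q₀) * q₀) := by
      ring
    linarith
  -- Step 3: the `(1,0,0)` and `(0,1,0)` pieces, modulo the rotors
  have hB1 : |∑ d ∈ Sᶜ, ∑ i₁, ∑ i₂, X d n t * (α i₁ i₂ d (1, 0, 0) * (X i₁ (n + 1) t * X i₂ n t)) +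
      ∑ d ∈ Sᶜ, ∑ i₁, ∑ i₂, X d n t * (α i₁ i₂ d (0, 1, 0) * (X i₁ n t * X i₂ (n + 1) t))| ≤
      2 * ((m : ℝ) ^ 3 * (Mα * (p₁ + q₁) * p₀ * q₀)) := by
    have hs100 : ∑ d ∈ Sᶜ, ∑ i₁, ∑ i₂, X d n t * (α i₁ i₂ d (1, 0, 0) * (X i₁ (n + 1) t * X i₂ n t)) =
        ∑ d ∈ Sᶜ, ∑ i₁ ∈ univ, ∑ i₂ ∈ S, X d n t * (α i₁ i₂ d (1, 0, 0) * (X i₁ (n + 1) t * X i₂ n t)) +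
        ∑ d ∈ Sᶜ, ∑ i₁ ∈ univ, ∑ i₂ ∈ Sᶜ,
          X d n t * (α i₁ i₂ d (1, 0, 0) * (X i₁ (n + 1) t * X i₂ n t)) := by
      rw [← forwardSourceSmoothing_split_inner S Sᶜ univ]
    have hs010 : ∑ d ∈ Sᶜ, ∑ i₁, ∑ i₂, X d n t * (α i₁ i₂ d (0, 1, 0) * (X i₁ n t * X i₂ (n + 1) t)) =
        ∑ d ∈ Sᶜ, ∑ i₁ ∈ S, ∑ i₂, X d n t * (α i₁ i₂ d (0, 1, 0) * (X i₁ n t * X i₂ (n + 1) t)) +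
        ∑ d ∈ Sᶜ, ∑ i₁ ∈ Sᶜ, ∑ i₂, X d n t * (α i₁ i₂ d (0, 1, 0) * (X i₁ n t * X i₂ (n + 1) t)) := by
      rw [forwardSourceSmoothing_split_mid S]
    have hrot := forwardSourceSmoothing_rotor_eq_zero hs hc Sᶜ (fun d hd => hS d (hDmem d hd))
      (fun i => X i n t) (fun i => X i (n + 1) t)
    have hkey : ∑ d ∈ Sᶜ, ∑ i₁, ∑ i₂, X d n t * (α i₁ i₂ d (1, 0, 0) * (X i₁ (n + 1) t * X i₂ n t)) +
        ∑ d ∈ Sᶜ, ∑ i₁, ∑ i₂, X d n t * (α i₁ i₂ d (0, 1, 0) * (X i₁ n t * X i₂ (n + 1) t)) =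
        ∑ d ∈ Sᶜ, ∑ i₁ ∈ univ, ∑ i₂ ∈ S, X d n t * (α i₁ i₂ d (1, 0, 0) * (X i₁ (n + 1) t * X i₂ n t)) +
        ∑ d ∈ Sᶜ, ∑ i₁ ∈ S, ∑ i₂, X d n t * (α i₁ i₂ d (0, 1, 0) * (X i₁ n t * X i₂ (n + 1) t)) := by
      rw [hs100, hs010]
      linarith [hrot]
    rw [hkey]
    refine (abs_add_le _ _).trans ?_
    have h1 : |∑ d ∈ Sᶜ, ∑ i₁ ∈ univ, ∑ i₂ ∈ S,
        X d n t * (α i₁ i₂ d (1, 0, 0) * (X i₁ (n + 1) t * X i₂ n t))|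
        ≤ (m : ℝ) ^ 3 * (Mα * (p₁ + q₁) * p₀ * q₀) :=
      forwardSourceSmoothing_abs_sum3_le (by positivity) fun d hd i₁ _ i₂ hi₂ =>
        forwardSourceSmoothing_abs_term_le hMα hw1 (hα _ _ _ _ h100) (hy i₁) (hS0 i₂ hi₂)
          (hD0 d (hDmem d hd))
    have h2 : |∑ d ∈ Sᶜ, ∑ i₁ ∈ S, ∑ i₂,
        X d n t * (α i₁ i₂ d (0, 1, 0) * (X i₁ n t * X i₂ (n + 1) t))|
        ≤ (m : ℝ) ^ 3 * (Mα * p₀ * (p₁ + q₁) * q₀) :=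
      forwardSourceSmoothing_abs_sum3_le (by positivity) fun d hd i₁ hi₁ i₂ _ =>
        forwardSourceSmoothing_abs_term_le hMα hp₀ (hα _ _ _ _ h010) (hS0 i₁ hi₁) (hy i₂)
          (hD0 d (hDmem d hd))
    have h3 : (m : ℝ) ^ 3 * (Mα * p₀ * (p₁ + q₁) * q₀) = (m : ℝ) ^ 3 * (Mα * (p₁ + q₁) * p₀ * q₀) := by
      ring
    linarith
  -- Step 4: the `(0,0,1)` piece needs two sources on shell `n - 1`
  have hB001 : |∑ d ∈ Sᶜ, ∑ i₁, ∑ i₂, X d n t * (α i₁ i₂ d (0, 0, 1) * (X i₁ (n - 1) t * X i₂ (n - 1) t))| ≤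
      (m : ℝ) ^ 3 * (Mα * pm * pm * q₀) := by
    refine forwardSourceSmoothing_abs_sum3_le (by positivity) fun d hd i₁ _ i₂ _ => ?_
    by_cases hi₁ : i₁ ∈ S
    · by_cases hi₂ : i₂ ∈ S
      · exact forwardSourceSmoothing_abs_term_le hMα hpm (hα _ _ _ _ h001) (hSm i₁ hi₁)
          (hSm i₂ hi₂) (hD0 d (hDmem d hd))
      · have hz : α i₁ i₂ d (0, 0, 1) = 0 := by rw [hs i₁ i₂ d 0 0 1 h001]; exact hS i₂ hi₂ i₁ d
        rw [hz, zero_mul, mul_zero, abs_zero]; positivity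
    · rw [hS i₁ hi₁ i₂ d, zero_mul, mul_zero, abs_zero]; positivity
  -- Step 5: assemble
  rw [hΦ]
  calc |(1 + ε₀) ^ ((5 : ℝ) * n / 2) * (∑ d ∈ Sᶜ, ∑ i₁, ∑ i₂, X d n t * (α i₁ i₂ d (0, 0, 0) * (X i₁ n t * X i₂ n t)) +
          ∑ d ∈ Sᶜ, ∑ i₁, ∑ i₂, X d n t * (α i₁ i₂ d (1, 0, 0) * (X i₁ (n + 1) t * X i₂ n t)) +
          ∑ d ∈ Sᶜ, ∑ i₁, ∑ i₂, X d n t * (α i₁ i₂ d (0, 1, 0) * (X i₁ n t * X i₂ (n + 1) t))) +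
        (1 + ε₀) ^ ((5 : ℝ) * ((n : ℝ) - 1) / 2) * ∑ d ∈ Sᶜ, ∑ i₁, ∑ i₂, X d n t * (α i₁ i₂ d (0, 0, 1) * (X i₁ (n - 1) t * X i₂ (n - 1) t))|
      ≤ (1 + ε₀) ^ ((5 : ℝ) * n / 2) * |∑ d ∈ Sᶜ, ∑ i₁, ∑ i₂, X d n t * (α i₁ i₂ d (0, 0, 0) * (X i₁ n t * X i₂ n t)) +
          ∑ d ∈ Sᶜ, ∑ i₁, ∑ i₂, X d n t * (α i₁ i₂ d (1, 0, 0) * (X i₁ (n + 1) t * X i₂ n t)) +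
          ∑ d ∈ Sᶜ, ∑ i₁, ∑ i₂, X d n t * (α i₁ i₂ d (0, 1, 0) * (X i₁ n t * X i₂ (n + 1) t))| +
        (1 + ε₀) ^ ((5 : ℝ) * ((n : ℝ) - 1) / 2) * |∑ d ∈ Sᶜ, ∑ i₁, ∑ i₂, X d n t * (α i₁ i₂ d (0, 0, 1) * (X i₁ (n - 1) t * X i₂ (n - 1) t))| := by
        refine (abs_add_le _ _).trans ?_
        rw [abs_mul, abs_mul, abs_of_nonneg hP, abs_of_nonneg hQ]
    _ ≤ (1 + ε₀) ^ ((5 : ℝ) * n / 2) * (2 * ((m : ℝ) ^ 3 * (Mα * p₀ * (p₀ + q₀) * q₀)) +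
          2 * ((m : ℝ) ^ 3 * (Mα * (p₁ + q₁) * p₀ * q₀))) +
        (1 + ε₀) ^ ((5 : ℝ) * ((n : ℝ) - 1) / 2) * ((m : ℝ) ^ 3 * (Mα * pm * pm * q₀)) := by
        refine add_le_add (mul_le_mul_of_nonneg_left ?_ hP) (mul_le_mul_of_nonneg_left hB001 hQ)
        rw [add_assoc]
        exact (abs_add_le _ _).trans (add_le_add hB000 hB1)
    _ = _ := by ring

end Summit.NavierStokesRegularity.NavierStokesRegularity.Theorems

end
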